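import Summits.Ventures.HSemireg.Pad4TowerStaticTorus

/-!
# Venture HSemireg — PAD-4 on 𝔅(μ₄): LEMMA T — TORUS BLINDNESS OF THE STATIC GAME, part 1∕2: the rotation primitives and RULE D (gs-eng-2 g53)

HONEST FRAMING. Lean index of the computation cell `pub-hsemireg` (S4-PUSH, H2 door PAD-4, line stmt-HodgeConjecture-18881), written by the
cell's second-code engine `gs-eng-2` (g53). Census-neutral: a theorem ABOUT THE TYPED STATIC PREDICATES of record (`RuleDMu4Closed` of
`Pad4TowerRuleDMu4`; `XMinusClosed`, `XPlusClosed`, `A2IMinusClosed`, `A2IPlusClosed` of `Pad4TowerXresFamilies`; `InDiamond` of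
`Pad4TowerDiamondMu4`; `StaticH1` of `Pad4TowerSeedB1`); nothing here is an object, a σ, a seed or a census row; NOTHING HERE SAYS THAT HC ∕ HC_CM ∕
HC_AV ∕ H2 HOLDS OR FAILS. No `sorry`, no `axiom`, no `instance`, no notation, no Literature fact.

WHAT. The torus `(ℤ∕4)⁴` acts on 𝔅(μ₄) cells factorwise by quarter-turn phase rotations (`Pad4TowerPhaseTorus.MCell.phase η`,
`(η·Z)_f = rot^{η_f}(Z_f)`, `rot(α, β) = (α, iβ)`), and on two-level configurations by rotating every cell of both levels
(`MConfig.phaseImage η`). **THEOREM (part 2, `Pad4TowerTorusBlind.staticFamilies_torusInvariant_familywise`): for EVERY `η` — partial moves (rotating one factor only)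
included — and every configuration `C`, each of `RuleDMu4Closed`, `XMinusClosed`, `XPlusClosed`, `A2IMinusClosed`, `A2IPlusClosed` holds on
`C.phaseImage η` iff it holds on `C`, and so does every `InDiamond h`;** hence `StaticH1`. THIS FILE (part 1): the point rotation `phasePt n` and its direction shift `dsh` (§2), cells (§3), configurations (typer-2's `MConfig.phaseImage` of `Pad4TowerStaticTorus`), service ∕ covers and **`ruleDMu4Closed_phaseImage`** (§4); part 2 does X, A2I, the diamond and the assembly. PROOF: every one of these
predicates is a first-order combination of per-factor primitives (`ray`, `UPartner`, `Sibling`, `MAgree(2)`, `NullBelow`, `Effective ∕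
Timelike ∕ Spacelike` of same-factor differences, `isApex`, `coord`, `Adapted`, `DirOK`, `EncDir`, `OnULineBelowEq`, `cabs`, `AxisPt`) in
which every DIRECTION variable is attached to one factor and is quantified inside the predicate; rotating factor `f` by `n` quarter turns
carries direction `k` to `dsh n k = k + 3n` (`phasePt_ray`), fixes `α`, `cabs`, `isApex` and the causal type of same-factor differences, and
re-indexes the direction quantifiers bijectively (`forall_dsh` ∕ `exists_dsh`); the only cross-factor comparisons (RULE D's coordinate VALUES)
are shift-covariant (`coord_phasePt`). The dual of `Pad4TowerRuleDMu4Dual` commutes with the rotation (`dual_phaseImage`), which transports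
the X⁻ ∕ A2I⁻ statements to X⁺ ∕ A2I⁺. This is bc5-plan g8 ∕ typer-2 g6's hypothesis-form `StaticFamiliesTorusInvariantFamilywise` ((T′-a)
`Pad4TowerStaticTorus`, not yet in the tree at the time of writing), PROVED in part 2 as `staticFamiliesTorusInvariantFamilywise_holds` (this part imports their statement file for `MConfig.phaseImage` and the two `def … : Prop`).

WHY IT MATTERS (note `general-structure∕PENCIL-B1ODD-gs2g53.md` §1, director-hodge R14.6 (3) ∕ R14.15): the static game of LINE 5 is
`(ℤ∕4) ≀ S₄`-symmetric; the torus acts TRANSITIVELY on the 16 phase-bit patterns while `FCc`, `InDiamond 8` and `Δ`-closure (Δ is central) are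
torus-invariant — so the ONLY input of the seed (T) `SeedB1OddDiamond8G1H1` that can distinguish an odd-weight FC class from an even one is the
`S₄`-closure half of `G1Closed`; `Δ`-closure + statics alone are parity-blind (typer-2's (σ-N) `not_seedB1OddDiamond8DeltaH1_of` takes this
theorem as its first hypothesis). Machine cross-check before the proof: `gs2∕g53∕pad4∕valtorus.py` (300 random instance-centred supports × 6
families, 0 failures).

SOURCES: `Pad4TowerPhaseTorus.lean` ((H): `PVec`, `phasePt`, `MCell.phase`, `MCell.phase_injective`), `Pad4TowerRuleDMu4.lean`,
`Pad4TowerRuleDMu4Dual.lean` (`dualPt`, `dualCell`, `MConfig.dual`), `Pad4TowerXStaticSafe2.lean` + `Pad4TowerXresFamilies.lean` (X ∕ A2I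
families), `Pad4TowerDiamondMu4.lean`, `Pad4TowerSeedB1.lean` (`StaticH1`); cell INBOX l.32657 (3), l.32658 R14.6 (3), bc5-plan g8 sketch
`SketchStaticTorus.lean` v3 bfdd78d090f0d634 ∕ typer-2 g6 staging `Pad4TowerStaticTorus.lean` v3 49126969d7678ba9 (the hypothesis-form statement). -/

namespace Summit.Ventures.HSemireg.Pad4Tower

open Finset

/-! ## §2 The point rotation `phasePt n` (= `deltaPt^[n]`): covariance with direction shift `k ↦ k + 3n` -/

/-- the direction shift of a rotation by `n` quarter turns: `k ↦ k − n = k + 3n`. -/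
abbrev dsh (n k : Fin 4) : Fin 4 := k + 3 * n

/-- rotating by `n` quarter turns carries the null ray of direction `k` to the one of direction `dsh n k`. -/
theorem phasePt_ray (n : Fin 4) (x : BPoint) (k : Fin 4) (e : ℤ) : phasePt n (ray x k e) = ray (phasePt n x) (dsh n k) e := by
  obtain ⟨a, b, c⟩ := x
  fin_cases n <;> fin_cases k <;> simp [phasePt, ray, dsh] <;> ring_nf

/-- a phase rotation fixes `α`. -/
theorem phasePt_fst (n : Fin 4) (x : BPoint) : (phasePt n x).1 = x.1 := by
  obtain ⟨a, b, c⟩ := x; fin_cases n <;> rfl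

/-- a phase rotation is injective on points. -/
theorem phasePt_injective (n : Fin 4) : Function.Injective (phasePt n) := by
  intro x y h
  obtain ⟨a, b, c⟩ := x; obtain ⟨a', b', c'⟩ := y
  fin_cases n <;> simp [phasePt, Prod.ext_iff] at h ⊢ <;> omega

/-- same-factor differences rotate with the points. -/
theorem bsub_phasePt (n : Fin 4) (x y : BPoint) : bsub (phasePt n x) (phasePt n y) = phasePt n (bsub x y) := by
  obtain ⟨a, b, c⟩ := x; obtain ⟨a', b', c'⟩ := y
  fin_cases n <;> simp [bsub, phasePt] <;> omega

/-- «effective» (future-causal) is rotation-invariant. -/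
theorem effective_phasePt (n : Fin 4) (d : BPoint) : Effective (phasePt n d) ↔ Effective d := by
  obtain ⟨a, b, c⟩ := d; fin_cases n <;> simp only [Effective, phasePt] <;> constructor <;> rintro ⟨h1, h2⟩ <;> refine ⟨h1, ?_⟩ <;>
    simp at h1 h2 ⊢ <;> nlinarith

/-- «timelike» is rotation-invariant. -/
theorem timelike_phasePt (n : Fin 4) (d : BPoint) : Timelike (phasePt n d) ↔ Timelike d := by
  obtain ⟨a, b, c⟩ := d; fin_cases n <;> simp [Timelike, phasePt] <;> constructor <;> intro h <;> nlinarith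

/-- «spacelike» is rotation-invariant. -/
theorem spacelike_phasePt (n : Fin 4) (d : BPoint) : Spacelike (phasePt n d) ↔ Spacelike d := by
  obtain ⟨a, b, c⟩ := d; fin_cases n <;> simp [Spacelike, phasePt] <;> constructor <;> intro h <;> nlinarith

/-- «strictly null-below» is rotation-invariant. -/
theorem nullBelow_phasePt (n : Fin 4) (y x : BPoint) : NullBelow (phasePt n y) (phasePt n x) ↔ NullBelow y x := by
  obtain ⟨a, b, c⟩ := x; obtain ⟨a', b', c'⟩ := y
  fin_cases n <;> simp [NullBelow, phasePt] <;> intro _ <;> constructor <;> intro h <;> nlinarith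

/-- apex points stay apex points. -/
theorem isApex_phasePt (n : Fin 4) (x : BPoint) : isApex (phasePt n x) ↔ isApex x := by
  obtain ⟨a, b, c⟩ := x; fin_cases n <;> simp [isApex, phasePt] <;> tauto

/-- the encoder's charge `cabs` is rotation-invariant. -/
theorem cabs_phasePt (n : Fin 4) (x : BPoint) : cabs (phasePt n x) = cabs x := by
  obtain ⟨a, b, c⟩ := x; fin_cases n <;> simp [cabs, phasePt, max_comm]

/-- RULE D's frame coordinate `k` becomes the coordinate `dsh n k` of the rotated point (same VALUE). -/
theorem coord_phasePt (n : Fin 4) (x : BPoint) (k : Fin 4) : coord (phasePt n x) (dsh n k) = coord x k := by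
  obtain ⟨a, b, c⟩ := x; fin_cases n <;> fin_cases k <;> simp [coord, phasePt, dsh]

/-- adaptedness to a frame follows the direction shift. -/
theorem adapted_phasePt (n : Fin 4) (x : BPoint) (k : Fin 4) : Adapted (phasePt n x) (dsh n k) ↔ Adapted x k := by
  obtain ⟨a, b, c⟩ := x; fin_cases n <;> fin_cases k <;> simp [Adapted, phasePt, dsh]

/-- the direction shift is injective. -/
theorem dsh_injective (n : Fin 4) : Function.Injective (dsh n) := fun k k' h => by simpa [dsh] using h

/-- the direction shift commutes with passing to the antipode. -/
theorem dsh_add_two (n k : Fin 4) : dsh n (k + 2) = dsh n k + 2 := by simp only [dsh]; abel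

/-- RULE D's admissible cover directions follow the shift. -/
theorem dirOK_phasePt (n : Fin 4) (x : BPoint) (k a : Fin 4) : DirOK (phasePt n x) (dsh n k) (dsh n a) ↔ DirOK x k a := by
  simp only [DirOK, isApex_phasePt, ← dsh_add_two, (dsh_injective n).eq_iff, (dsh_injective n).ne_iff]

/-- the shift is a bijection of the four directions (used to re-index `∀ k` ∕ `∃ r`). -/
def dshEquiv (n : Fin 4) : Fin 4 ≃ Fin 4 := Equiv.addRight (3 * n)

/-- `dshEquiv` is `dsh`. -/
theorem dshEquiv_apply (n k : Fin 4) : dshEquiv n k = dsh n k := rfl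

/-! ## §3 Cells: `MCell.phase η` and the leg ∕ cover relations -/

/-- the rotated cell, factorwise. -/
theorem phase_apply (η : PVec) (Z : MCell) (f : Fin 4) : Z.phase η f = phasePt (η f) (Z f) := rfl

/-- agreement off one factor is rotation-invariant. -/
theorem magree_phase (η : PVec) (P Z : MCell) (σ : Fin 4) : MAgree (P.phase η) (Z.phase η) σ ↔ MAgree P Z σ :=
  ⟨fun h g hg => phasePt_injective (η g) (h g hg), fun h g hg => by simp only [phase_apply, h g hg]⟩

/-- agreement off two factors is rotation-invariant. -/
theorem magree2_phase (η : PVec) (P Z : MCell) (g j : Fin 4) : MAgree2 (P.phase η) (Z.phase η) g j ↔ MAgree2 P Z g j :=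
  ⟨fun h f h1 h2 => phasePt_injective (η f) (h f h1 h2), fun h f h1 h2 => by simp only [phase_apply, h f h1 h2]⟩

/-- a leg in direction `k` becomes a leg in direction `dsh (η σ) k`. -/
theorem uPartner_phase (η : PVec) (Z q : MCell) (σ k : Fin 4) :
    UPartner (Z.phase η) (q.phase η) σ (dsh (η σ) k) ↔ UPartner Z q σ k := by
  simp only [UPartner, magree_phase, phase_apply, phasePt_fst]
  constructor
  · rintro ⟨h1, h2, h3⟩
    refine ⟨h1, h2, phasePt_injective (η σ) ?_⟩
    rw [h3, phasePt_ray]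
  · rintro ⟨h1, h2, h3⟩
    refine ⟨h1, h2, ?_⟩
    rw [h3, phasePt_ray, ← h3]

/-! ## §4 Configurations: the phase image, service, covers, RULE D -/

/-- membership in the lower level of the phase image. -/
theorem mem_phaseImage_lower {η : PVec} {C : MConfig} {X : MCell} :
    X ∈ (C.phaseImage η).lower ↔ ∃ Z ∈ C.lower, Z.phase η = X := by
  simp [MConfig.phaseImage, Finset.mem_image]

/-- membership in the upper level of the image. -/
theorem mem_phaseImage_upper {η : PVec} {C : MConfig} {X : MCell} :
    X ∈ (C.phaseImage η).upper ↔ ∃ P ∈ C.upper, P.phase η = X := by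
  simp [MConfig.phaseImage, Finset.mem_image]

/-- a rotated cell lies in the rotated lower level iff the cell lies in the lower level. -/
theorem phase_mem_phaseImage_lower {η : PVec} {C : MConfig} {Z : MCell} : Z.phase η ∈ (C.phaseImage η).lower ↔ Z ∈ C.lower := by
  rw [mem_phaseImage_lower]
  exact ⟨fun ⟨Z', hZ', e⟩ => MCell.phase_injective η e ▸ hZ', fun h => ⟨Z, h, rfl⟩⟩

/-- a rotated cell lies in the rotated upper level iff the cell lies in the upper level. -/
theorem phase_mem_phaseImage_upper {η : PVec} {C : MConfig} {P : MCell} : P.phase η ∈ (C.phaseImage η).upper ↔ P ∈ C.upper := by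
  rw [mem_phaseImage_upper]
  exact ⟨fun ⟨P', hP', e⟩ => MCell.phase_injective η e ▸ hP', fun h => ⟨P, h, rfl⟩⟩

/-- a universally quantified statement over the cells of the image is one over the cells of `C`. -/
theorem forall_phaseImage_upper {η : PVec} {C : MConfig} {p : MCell → Prop} :
    (∀ P ∈ (C.phaseImage η).upper, p P) ↔ ∀ P ∈ C.upper, p (P.phase η) := by
  constructor
  · intro h P hP; exact h _ (phase_mem_phaseImage_upper.mpr hP)
  · intro h X hX; obtain ⟨P, hP, rfl⟩ := mem_phaseImage_upper.mp hX; exact h P hP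

/-- a universal statement over the lower cells of the image is one over the lower cells of `C`. -/
theorem forall_phaseImage_lower {η : PVec} {C : MConfig} {p : MCell → Prop} :
    (∀ Z ∈ (C.phaseImage η).lower, p Z) ↔ ∀ Z ∈ C.lower, p (Z.phase η) := by
  constructor
  · intro h Z hZ; exact h _ (phase_mem_phaseImage_lower.mpr hZ)
  · intro h X hX; obtain ⟨Z, hZ, rfl⟩ := mem_phaseImage_lower.mp hX; exact h Z hZ

/-- an existential statement over the upper cells of the image is one over the upper cells of `C`. -/
theorem exists_phaseImage_upper {η : PVec} {C : MConfig} {p : MCell → Prop} :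
    (∃ P ∈ (C.phaseImage η).upper, p P) ↔ ∃ P ∈ C.upper, p (P.phase η) := by
  constructor
  · rintro ⟨X, hX, hp⟩; obtain ⟨P, hP, rfl⟩ := mem_phaseImage_upper.mp hX; exact ⟨P, hP, hp⟩
  · rintro ⟨P, hP, hp⟩; exact ⟨_, phase_mem_phaseImage_upper.mpr hP, hp⟩

/-- an existential statement over the lower cells of the image is one over the lower cells of `C`. -/
theorem exists_phaseImage_lower {η : PVec} {C : MConfig} {p : MCell → Prop} :
    (∃ Z ∈ (C.phaseImage η).lower, p Z) ↔ ∃ Z ∈ C.lower, p (Z.phase η) := by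
  constructor
  · rintro ⟨X, hX, hp⟩; obtain ⟨Z, hZ, rfl⟩ := mem_phaseImage_lower.mp hX; exact ⟨Z, hZ, hp⟩
  · rintro ⟨Z, hZ, hp⟩; exact ⟨_, phase_mem_phaseImage_lower.mpr hZ, hp⟩

/-- re-indexing a universal ∕ existential over the four directions along the shift. -/
theorem forall_dsh (n : Fin 4) {p : Fin 4 → Prop} : (∀ k, p (dsh n k)) ↔ ∀ k, p k :=
  ⟨fun h k => by simpa [dshEquiv, dsh] using h ((dshEquiv n).symm k), fun h k => h _⟩

/-- re-indexing an existential over the four directions along the shift. -/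
theorem exists_dsh (n : Fin 4) {p : Fin 4 → Prop} : (∃ k, p (dsh n k)) ↔ ∃ k, p k :=
  ⟨fun ⟨k, hk⟩ => ⟨_, hk⟩, fun ⟨k, hk⟩ => ⟨(dshEquiv n).symm k, by simpa [dshEquiv, dsh] using hk⟩⟩

section RuleD

variable (η : PVec) (C : MConfig)

/-- service below is torus-covariant (direction shifted on the served factor). -/
theorem mServedBelow_phase (Z : MCell) (f k : Fin 4) :
    MServedBelow (C.phaseImage η) (Z.phase η) f (dsh (η f) k) ↔ MServedBelow C Z f k := by
  simp only [MServedBelow, exists_phaseImage_upper, uPartner_phase]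

/-- service above is torus-covariant. -/
theorem mServedAbove_phase (P : MCell) (f k : Fin 4) :
    MServedAbove (C.phaseImage η) (P.phase η) f (dsh (η f) k) ↔ MServedAbove C P f k := by
  simp only [MServedAbove, exists_phaseImage_lower, uPartner_phase]

/-- settled coordinates below are torus-covariant. -/
theorem settledBelow_phase (Z : MCell) (f k : Fin 4) :
    SettledBelow (C.phaseImage η) (Z.phase η) f (dsh (η f) k) ↔ SettledBelow C Z f k := by
  simp only [SettledBelow]
  rw [← exists_dsh (η f)]
  simp only [mServedBelow_phase, ← dsh_add_two, (dsh_injective _).ne_iff]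

/-- settled coordinates above are torus-covariant. -/
theorem settledAbove_phase (P : MCell) (f k : Fin 4) :
    SettledAbove (C.phaseImage η) (P.phase η) f (dsh (η f) k) ↔ SettledAbove C P f k := by
  simp only [SettledAbove]
  rw [← exists_dsh (η f)]
  simp only [mServedAbove_phase, ← dsh_add_two, (dsh_injective _).ne_iff]

/-- the two-leg relation «`X g` lies `d ≥ 1` steps of direction `a` above `Y g`» on one factor, rotated. -/
theorem leg_phase (X Y : MCell) (g a : Fin 4) :
    ((Y.phase η g).1 < (X.phase η g).1 ∧ X.phase η g = ray (Y.phase η g) (dsh (η g) a) ((X.phase η g).1 - (Y.phase η g).1)) ↔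
      ((Y g).1 < (X g).1 ∧ X g = ray (Y g) a ((X g).1 - (Y g).1)) := by
  simp only [phase_apply, phasePt_fst]
  constructor
  · rintro ⟨h1, h2⟩; exact ⟨h1, phasePt_injective (η g) (by rw [h2, phasePt_ray])⟩
  · rintro ⟨h1, h2⟩; refine ⟨h1, ?_⟩; rw [h2, phasePt_ray, ← h2]

/-- (r2a) covers below are torus-covariant (both directions shifted on their factors). -/
theorem mCoverBelow_phase (Z : MCell) (g a j b : Fin 4) :
    MCoverBelow (C.phaseImage η) (Z.phase η) g (dsh (η g) a) j (dsh (η j) b) ↔ MCoverBelow C Z g a j b := by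
  simp only [MCoverBelow, exists_phaseImage_upper, magree2_phase]
  refine exists_congr fun P => and_congr_right fun _ => and_congr_right fun _ => ?_
  have h1 := leg_phase η Z P g a
  have h2 := leg_phase η Z P j b
  constructor
  · rintro ⟨a1, a2, a3, a4⟩; exact ⟨(h1.mp ⟨a1, a2⟩).1, (h1.mp ⟨a1, a2⟩).2, (h2.mp ⟨a3, a4⟩).1, (h2.mp ⟨a3, a4⟩).2⟩
  · rintro ⟨a1, a2, a3, a4⟩; exact ⟨(h1.mpr ⟨a1, a2⟩).1, (h1.mpr ⟨a1, a2⟩).2, (h2.mpr ⟨a3, a4⟩).1, (h2.mpr ⟨a3, a4⟩).2⟩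

/-- (r2a) covers above are torus-covariant. -/
theorem mCoverAbove_phase (P : MCell) (g a j b : Fin 4) :
    MCoverAbove (C.phaseImage η) (P.phase η) g (dsh (η g) a) j (dsh (η j) b) ↔ MCoverAbove C P g a j b := by
  simp only [MCoverAbove, exists_phaseImage_lower, magree2_phase]
  refine exists_congr fun N => and_congr_right fun _ => and_congr_right fun _ => ?_
  have h1 := leg_phase η N P g a
  have h2 := leg_phase η N P j b
  constructor
  · rintro ⟨a1, a2, a3, a4⟩; exact ⟨(h1.mp ⟨a1, a2⟩).1, (h1.mp ⟨a1, a2⟩).2, (h2.mp ⟨a3, a4⟩).1, (h2.mp ⟨a3, a4⟩).2⟩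
  · rintro ⟨a1, a2, a3, a4⟩; exact ⟨(h1.mpr ⟨a1, a2⟩).1, (h1.mpr ⟨a1, a2⟩).2, (h2.mpr ⟨a3, a4⟩).1, (h2.mpr ⟨a3, a4⟩).2⟩

/-- covered coordinate pairs below are torus-covariant. -/
theorem coveredBelow_phase (Z : MCell) (g k j k' : Fin 4) :
    CoveredBelow (C.phaseImage η) (Z.phase η) g (dsh (η g) k) j (dsh (η j) k') ↔ CoveredBelow C Z g k j k' := by
  simp only [CoveredBelow]
  rw [← exists_dsh (η g)]
  refine exists_congr fun a => ?_
  rw [← exists_dsh (η j)]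
  refine exists_congr fun b => ?_
  rw [phase_apply, dirOK_phasePt, phase_apply, dirOK_phasePt, mCoverBelow_phase]

/-- covered coordinate pairs above are torus-covariant. -/
theorem coveredAbove_phase (P : MCell) (g k j k' : Fin 4) :
    CoveredAbove (C.phaseImage η) (P.phase η) g (dsh (η g) k) j (dsh (η j) k') ↔ CoveredAbove C P g k j k' := by
  simp only [CoveredAbove]
  rw [← exists_dsh (η g)]
  refine exists_congr fun a => ?_
  rw [← exists_dsh (η j)]
  refine exists_congr fun b => ?_
  rw [phase_apply, dirOK_phasePt, phase_apply, dirOK_phasePt, mCoverAbove_phase]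

/-- **RULE D at an `N`-cell is torus-blind.** -/
theorem ruleDMu4N_phase (Z : MCell) : RuleDMu4N (C.phaseImage η) (Z.phase η) ↔ RuleDMu4N C Z := by
  simp only [RuleDMu4N]
  refine forall_congr' fun g => forall_congr' fun j => imp_congr_right fun _ => ?_
  rw [← forall_dsh (η g)]
  refine forall_congr' fun k => ?_
  rw [← forall_dsh (η j)]
  refine forall_congr' fun k' => ?_
  rw [phase_apply, adapted_phasePt, phase_apply, adapted_phasePt, coord_phasePt, coord_phasePt,
    settledBelow_phase, settledBelow_phase, coveredBelow_phase]

/-- **RULE D at a `P`-cell is torus-blind.** -/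
theorem ruleDMu4P_phase (P : MCell) : RuleDMu4P (C.phaseImage η) (P.phase η) ↔ RuleDMu4P C P := by
  simp only [RuleDMu4P]
  refine forall_congr' fun g => forall_congr' fun j => imp_congr_right fun _ => ?_
  rw [← forall_dsh (η g)]
  refine forall_congr' fun k => ?_
  rw [← forall_dsh (η j)]
  refine forall_congr' fun k' => ?_
  rw [phase_apply, adapted_phasePt, phase_apply, adapted_phasePt, coord_phasePt, coord_phasePt,
    settledAbove_phase, settledAbove_phase, coveredAbove_phase]

/-- **RULE-D closure is torus-blind** (the `RuleDMu4Closed` conjunct of (σ-T′)). -/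
theorem ruleDMu4Closed_phaseImage : RuleDMu4Closed (C.phaseImage η) ↔ RuleDMu4Closed C := by
  simp only [RuleDMu4Closed, forall_phaseImage_lower, forall_phaseImage_upper, ruleDMu4N_phase, ruleDMu4P_phase]

end RuleD

end Summit.Ventures.HSemireg.Pad4Tower
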